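import Summits.Ventures.PercRepro.MSTightConjTTwinFree
import Summits.Ventures.PercRepro.MSTightMapTransport
import Summits.Ventures.PercRepro.MSTightConjTSingCandidate

/-!
# Conjecture (T) is a theorem: `ConjT α`

Dossier proofs/MINE1-theoremS.md, Addendum 56. The candidate Prop `ConjT α` of Addendum 45 —
at every tightening direction `r` of an excess-one family `F` with `∅, univ ∉ F`, empty core and
full support, `diffsY r F ⊆ diffsX r F` — is proved by strong induction on the size of the ground
set (`conjT_aux`, `conjT`). Twin-free families are MSTightConjTTwinFree.lean; a family with a twin
pair `a ≠ b` reduces to its projection `proj b F` along `b` (the twin projection keeps `|F|` and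
`|F \\ F|`, `card_proj_of_twin` / `card_diffs_proj_of_twin`, and the tightness of the trace,
`tight_proj_proj_of_twin`), transported to the subtype `{x // x ≠ b}` where it has full support
(MSTightMapTransport.lean); Conjecture (T) for the projection gives it for `F` because every
difference of `F` and every type-I difference is twin-closed (`diffsY_subset_diffsX_of_proj_twin`).
Consequence for the lane's V-chain: `singNonMonotone_of_residue : SingCaseIResidue α →
SingNonMonotone α` (the hypothesis `ConjT α` of `singNonMonotone_of_conjT_of_residue` discharged).
-/

namespace PercRepro.MSTight

open Finset
open scoped FinsetFamily

section TwinStep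

variable {α : Type*} [DecidableEq α] {r a b : α} {F : Finset (Finset α)}

/-- A twin of a tightening direction `r` of an excess-one family is `r` itself. -/
theorem eq_of_twin_of_tight_proj (hF : (F \\ F).card = F.card + 1) (hP : Tight (proj r F))
    (hb : Twin F r b) : b = r := by
  by_contra hbr
  have h1 := card_proj_of_twin hb.symm hbr
  have h2 := card_diffs_proj_of_twin hb.symm hbr
  have h3 : (proj r F \\ proj r F).card = (proj r F).card := hP
  omega

/-- Twins off `r` stay twins in the trace at `r`. -/
theorem twin_proj_of_twin (hab : Twin F a b) (har : a ≠ r) (hbr : b ≠ r) :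
    Twin (proj r F) a b := by
  intro p hp
  obtain ⟨t, ht, rfl⟩ := mem_proj.1 hp
  simp only [mem_erase]
  constructor
  · rintro ⟨-, hat⟩
    exact ⟨hbr, (hab t ht).1 hat⟩
  · rintro ⟨-, hbt⟩
    exact ⟨har, (hab t ht).2 hbt⟩

/-- The trace at `r` of the projection along a twin `b` (of some `a`, both off `r`) is tight when
the trace at `r` is. -/
theorem tight_proj_proj_of_twin (hP : Tight (proj r F)) (hab : Twin F a b) (hne : a ≠ b)
    (har : a ≠ r) (hbr : b ≠ r) : Tight (proj r (proj b F)) := by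
  rw [proj_proj_comm]
  have htw : Twin (proj r F) a b := twin_proj_of_twin hab har hbr
  unfold Tight at hP ⊢
  rw [card_proj_of_twin htw hne, card_diffs_proj_of_twin htw hne]
  exact hP

/-- Every difference of the projection is the projection of a difference. -/
theorem exists_erase_eq_of_mem_diffs_proj {d' : Finset α} (hd' : d' ∈ proj b F \\ proj b F) :
    ∃ d ∈ F \\ F, d.erase b = d' := by
  rw [proj_eq_image_sdiff, diffs_image_sdiff, mem_image] at hd'
  obtain ⟨d, hd, rfl⟩ := hd'
  exact ⟨d, hd, (sdiff_singleton_eq_erase b d).symm⟩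

/-- Differences are twin-closed. -/
theorem twin_mem_diffs_iff (hab : Twin F a b) {d : Finset α} (hd : d ∈ F \\ F) :
    a ∈ d ↔ b ∈ d := by
  obtain ⟨A, hA, B, hB, rfl⟩ := mem_diffs.1 hd
  simp only [mem_sdiff]
  rw [hab A hA, hab B hB]

/-- **The twin step.** Conjecture (T) at `r` for the projection along a twin `b` (of `a`, both off
`r`) gives it for `F`. -/
theorem diffsY_subset_diffsX_of_proj_twin (hab : Twin F a b) (hne : a ≠ b) (har : a ≠ r)
    (hbr : b ≠ r) (h : diffsY r (proj b F) ⊆ diffsX r (proj b F)) :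
    diffsY r F ⊆ diffsX r F := by
  intro z hz
  rw [mem_diffsY_iff] at hz
  have h1 : z.erase b ∈ diffsY r (proj b F) := by
    rw [mem_diffsY_iff]
    refine ⟨fun h => hz.1 (mem_of_mem_erase h), ?_⟩
    rw [← erase_insert_of_ne hbr.symm]
    exact erase_mem_diffs_proj hz.2
  have h2 := h h1
  rw [mem_diffsX_iff] at h2
  obtain ⟨d, hd, hdz⟩ := exists_erase_eq_of_mem_diffs_proj h2.1
  have hrd : r ∉ d := fun hr => h2.2 (hdz ▸ mem_erase.2 ⟨hbr.symm, hr⟩)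
  have hzcl : a ∈ z ↔ b ∈ z := by
    have h := twin_mem_diffs_iff hab hz.2
    simp only [mem_insert] at h
    constructor
    · intro haz
      exact (h.1 (Or.inr haz)).resolve_left hbr
    · intro hbz
      exact (h.2 (Or.inr hbz)).resolve_left har
  have hdcl : a ∈ d ↔ b ∈ d := twin_mem_diffs_iff hab hd
  have hzd : z = d := by
    ext x
    by_cases hxb : x = b
    · subst hxb
      have hax : a ∈ d.erase x ↔ a ∈ z.erase x := by rw [hdz]
      simp only [mem_erase, ne_eq, hne, not_false_eq_true, true_and] at hax
      rw [← hzcl, ← hdcl, hax]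
    · have hx : x ∈ d.erase b ↔ x ∈ z.erase b := by rw [hdz]
      simp only [mem_erase, ne_eq, hxb, not_false_eq_true, true_and] at hx
      exact hx.symm
  rw [mem_diffsX_iff, hzd]
  exact ⟨hd, hrd⟩

/-- `∅` is not a member of the projection along a twin (of an element `a ≠ b`) when `∅ ∉ F`. -/
theorem empty_notMem_proj_of_twin (hab : Twin F a b) (hne : a ≠ b) (hE : (∅ : Finset α) ∉ F) :
    (∅ : Finset α) ∉ proj b F := by
  intro h
  obtain ⟨t, ht, hte⟩ := mem_proj.1 h
  rcases (erase_eq_empty_iff t b).1 hte with rfl | rfl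
  · exact hE ht
  · exact hne (mem_singleton.1 ((hab _ ht).2 (mem_singleton_self b)))

/-- `univ.erase b` is not a member of the projection along a twin `b` of `a` when `univ ∉ F`. -/
theorem erase_univ_notMem_proj_of_twin [Fintype α] (hab : Twin F a b) (hne : a ≠ b)
    (hU : (univ : Finset α) ∉ F) : univ.erase b ∉ proj b F := by
  intro h
  obtain ⟨t, ht, hte⟩ := mem_proj.1 h
  by_cases hbt : b ∈ t
  · have : t = univ := by rw [← insert_erase hbt, hte, insert_erase (mem_univ b)]
    exact hU (this ▸ ht)
  · rw [erase_eq_of_notMem hbt] at hte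
    have hat : a ∈ t := by
      rw [hte]
      exact mem_erase.2 ⟨hne, mem_univ a⟩
    exact hbt ((hab t ht).1 hat)

/-- The image of `univ` of the subtype `{x // x ≠ b}` is `univ.erase b`. -/
theorem univ_map_subtype_ne [Fintype α] (b : α) :
    (univ : Finset {x : α // x ≠ b}).map (Function.Embedding.subtype (· ≠ b)) = univ.erase b := by
  rw [← subtype_univ (· ≠ b), subtype_map, filter_ne']

end TwinStep

section Induction

universe u

/-- **Conjecture (T), by strong induction on the size of the ground set.** -/
theorem conjT_aux : ∀ (n : ℕ) (γ : Type u) [Fintype γ] [DecidableEq γ], Fintype.card γ = n →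
    ∀ (F : Finset (Finset γ)) (r : γ), (F \\ F).card = F.card + 1 → (∅ : Finset γ) ∉ F →
      (univ : Finset γ) ∉ F → (∀ a, ∃ t ∈ F, a ∉ t) → (∀ a, ∃ t ∈ F, a ∈ t) → Tight (proj r F) →
        diffsY r F ⊆ diffsX r F := by
  intro n
  induction n using Nat.strong_induction_on with
  | _ n ih =>
  intro γ _ _ hn F r hF hE hU hcore hsupp hP
  by_cases htw : ∀ a b, Twin F a b → a = b
  · exact diffsY_subset_diffsX_of_twinFree htw hF hE hU hcore hsupp hP
  · push Not at htw
    obtain ⟨a, b, hab, hne⟩ := htw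
    have har : a ≠ r := fun h => by
      have hrb : Twin F r b := h ▸ hab
      exact hne (h.trans (eq_of_twin_of_tight_proj hF hP hrb).symm)
    have hbr : b ≠ r := fun h => by
      have hra : Twin F r a := h ▸ hab.symm
      have har' : a = r := eq_of_twin_of_tight_proj hF hP hra
      exact hne (har'.trans h.symm)
    -- the projection along `b`
    have hF'avoid : ∀ s ∈ proj b F, b ∉ s := fun s hs => notMem_of_mem_proj hs
    have hF'exc : (proj b F \\ proj b F).card = (proj b F).card + 1 := by
      rw [card_proj_of_twin hab hne, card_diffs_proj_of_twin hab hne]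
      exact hF
    have hF'E : (∅ : Finset γ) ∉ proj b F := empty_notMem_proj_of_twin hab hne hE
    have hF'U : univ.erase b ∉ proj b F := erase_univ_notMem_proj_of_twin hab hne hU
    have hF'P : Tight (proj r (proj b F)) := tight_proj_proj_of_twin hP hab hne har hbr
    -- the restriction to the subtype `{x // x ≠ b}`
    have hmap : famMap (Function.Embedding.subtype (· ≠ b))
        ((proj b F).image (Finset.subtype (· ≠ b))) = proj b F := famMap_subtype_image hF'avoid
    have hcard : Fintype.card {x : γ // x ≠ b} = n - 1 := by
      rw [Fintype.card_subtype_compl, Fintype.card_subtype_eq, hn]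
    have hpos : 0 < n := by
      rw [← hn]
      exact Fintype.card_pos_iff.2 ⟨b⟩
    have hlt : n - 1 < n := by omega
    have h1 : ((proj b F).image (Finset.subtype (· ≠ b)) \\
        (proj b F).image (Finset.subtype (· ≠ b))).card =
        ((proj b F).image (Finset.subtype (· ≠ b))).card + 1 := by
      rw [← card_diffs_famMap_eq_iff (Function.Embedding.subtype (· ≠ b)), hmap]
      exact hF'exc
    have h2 : (∅ : Finset {x : γ // x ≠ b}) ∉ (proj b F).image (Finset.subtype (· ≠ b)) := by
      intro h
      have h' := (mem_subtype_image hF'avoid).1 h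
      rw [map_empty] at h'
      exact hF'E h'
    have h3 : (univ : Finset {x : γ // x ≠ b}) ∉ (proj b F).image (Finset.subtype (· ≠ b)) := by
      intro h
      have h' := (mem_subtype_image hF'avoid).1 h
      rw [univ_map_subtype_ne] at h'
      exact hF'U h'
    have h4 : ∀ x : {x : γ // x ≠ b}, ∃ t ∈ (proj b F).image (Finset.subtype (· ≠ b)), x ∉ t := by
      intro x
      obtain ⟨t, ht, hxt⟩ := hcore x.1
      refine ⟨(t.erase b).subtype (· ≠ b), mem_image_of_mem _ (mem_proj.2 ⟨t, ht, rfl⟩), ?_⟩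
      rw [mem_subtype]
      exact fun h => hxt (mem_of_mem_erase h)
    have h5 : ∀ x : {x : γ // x ≠ b}, ∃ t ∈ (proj b F).image (Finset.subtype (· ≠ b)), x ∈ t := by
      intro x
      obtain ⟨t, ht, hxt⟩ := hsupp x.1
      exact ⟨(t.erase b).subtype (· ≠ b), mem_image_of_mem _ (mem_proj.2 ⟨t, ht, rfl⟩),
        mem_subtype.2 (mem_erase.2 ⟨x.2, hxt⟩)⟩
    have h6 : Tight (proj (⟨r, hbr.symm⟩ : {x : γ // x ≠ b})
        ((proj b F).image (Finset.subtype (· ≠ b)))) := by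
      rw [← tight_famMap_iff (Function.Embedding.subtype (· ≠ b)), ← proj_famMap, hmap]
      exact hF'P
    have hIH := ih (n - 1) hlt {x : γ // x ≠ b} hcard _ _ h1 h2 h3 h4 h5 h6
    have hT' : diffsY r (proj b F) ⊆ diffsX r (proj b F) := by
      have h := diffsY_subset_diffsX_of_famMap (e := Function.Embedding.subtype (· ≠ b)) hIH
      rwa [hmap] at h
    exact diffsY_subset_diffsX_of_proj_twin hab hne har hbr hT'

variable {α : Type*} [DecidableEq α] [Fintype α]

/-- **CONJECTURE (T) IS A THEOREM.** -/
theorem conjT : ConjT α := by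
  intro F r hF hE hU hcore hsupp hP
  exact conjT_aux _ α rfl F r hF hE hU hcore hsupp hP

/-- The V-chain with (T) discharged: `SingCaseIResidue α → SingNonMonotone α`. -/
theorem singNonMonotone_of_residue (hR : SingCaseIResidue α) : SingNonMonotone α :=
  singNonMonotone_of_conjT_of_residue conjT hR

end Induction

end PercRepro.MSTight
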